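import Literature.Barriers.AtomisticToContinuum.DisorderedHarmonicChainRestart
import Mathlib.Analysis.SpecialFunctions.Trigonometric.Bounds
import Mathlib.Algebra.Order.Round
import HarnessLib

/-!
# Ajanki–Huveneers 2011: the deterministic sweep of the phase — most steps are away from `ℤ`

Fourth file of the integration-by-parts route to the low-frequency upper bound (U) of
`…Transfer.lean` (O. Ajanki, F. Huveneers, CMP **301** (2011) 841–883, arXiv:1003.1076). Cor. 3.4
(i) of the paper says that the lifted phase increases at every step by an amount in
`[(1+b₋)w - Cw², (1+b₊)w + Cw²]` (`ahStep_increment_bounds`, PROVED in `…PhasesProofs.lean`); the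
paper uses this through "the lack of diffusivity of the chain around `0`" (Cor. 3.4 (iii)) and the
hypothesis `wn ≥ κ` of Prop. 5.1 ("one now uses the hypothesis `nw ≥ κ` … one can choose `ε'`
such that `supp(T^m u) ∩ B(0,ε₁) = ∅`", Step 2 of its proof). We need the same input in a counted
form, PROVED here for any real sequence with increments in `[d₁, d₂]`, `d₁ > 0`:

* `card_near_int_le`: among `K` consecutive indices, at most `(K d₂ + 3)(2η/d₁ + 1)` have their
  value within `η ≤ 1/2` of an integer (fibres of `k ↦ round X_k` are short runs; the rounded
  values lie in an integer interval of length `≤ K d₂ + 2`);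
* `card_far_int_ge`: hence at least `K/2` of them are at distance `≥ η` from `ℤ`, as soon as
  `16ηd₂ ≤ d₁`, `d₂ ≤ 1/8`, `48η ≤ d₁K`, `24 ≤ K`;
* `sin_sq_ge_of_far_int`: `dist(x, ℤ) ≥ η` gives `sin²(πx) ≥ 4η²`;
* `ahPhase_far_int_card_ge`: the specialisation to the phase chain — for `κ > 0` there are
  `w₁, η > 0` such that for `0 < w ≤ w₁`, reduced masses in `[b₋, b₊]`, every start and every
  window of `K` consecutive steps with `wK ≥ κ`, at least `K/2` steps `k` have `sin²(πX_k) ≥ 4η²`.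

[cite: AjankiHuveneers2011, Cor. 3.4 (i), (iii); proof of Prop. 5.1, Step 2]
-/

noncomputable section

open Real Finset

namespace Literature.Barriers.AtomisticToContinuum.HeatConduction

/-! ### Counting lemmas -/

/-- A finite set of naturals any two elements of which differ by at most `L` has at most
`L + 1` elements. [folklore] -/
theorem card_le_of_sub_le {T : Finset ℕ} {L : ℕ} (h : ∀ a ∈ T, ∀ b ∈ T, b - a ≤ L) :
    T.card ≤ L + 1 := by
  rcases T.eq_empty_or_nonempty with hT | hT
  · simp [hT]
  · set m := T.min' hT with hm
    have hsub : T ⊆ Finset.Icc m (m + L) := by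
      intro b hb
      rw [Finset.mem_Icc]
      have h1 : m ≤ b := T.min'_le b hb
      have h2 : b - m ≤ L := h m (T.min'_mem hT) b hb
      omega
    calc T.card ≤ (Finset.Icc m (m + L)).card := Finset.card_le_card hsub
      _ = L + 1 := by rw [Nat.card_Icc]; omega

/-- For an increasing sequence with steps `≥ d₁ > 0`: two indices `a ≤ b` whose values are both
within `η` of the same real number satisfy `b - a ≤ ⌊2η/d₁⌋`. [folklore] -/
theorem sub_le_of_near {X : ℕ → ℝ} {d₁ η : ℝ} (hd₁ : 0 < d₁)
    (hinc : ∀ k, d₁ ≤ X (k + 1) - X k) {a b : ℕ} (hab : a ≤ b) {N : ℝ}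
    (ha : |X a - N| < η) (hb : |X b - N| < η) : b - a ≤ ⌊2 * η / d₁⌋₊ := by
  have hgrow : ∀ n, X a + n * d₁ ≤ X (a + n) := by
    intro n
    induction n with
    | zero => simp
    | succ n ih =>
      have := hinc (a + n)
      rw [show a + (n + 1) = a + n + 1 by omega]
      push_cast
      linarith
  have h1 := hgrow (b - a)
  rw [show a + (b - a) = b by omega] at h1
  have h2 : X b - X a < 2 * η := by
    have := abs_lt.mp ha
    have := abs_lt.mp hb
    linarith
  have h3 : ((b - a : ℕ) : ℝ) * d₁ < 2 * η := by linarith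
  have h4 : ((b - a : ℕ) : ℝ) < 2 * η / d₁ := by rwa [lt_div_iff₀ hd₁]
  exact Nat.le_floor h4.le

/-- **At most `(Kd₂ + 3)(2η/d₁ + 1)` of `K` consecutive values of a sequence with increments in
`[d₁, d₂]`, `d₁ > 0`, are within `η` of an integer.** [cite: AjankiHuveneers2011, Cor. 3.4 (i), (iii)] -/
theorem card_near_int_le {X : ℕ → ℝ} {d₁ d₂ η : ℝ} (hd₁ : 0 < d₁) (hη : 0 < η)
    (hinc : ∀ k, d₁ ≤ X (k + 1) - X k) (hinc2 : ∀ k, X (k + 1) - X k ≤ d₂) (k₀ K : ℕ) :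
    ((((Finset.Ico k₀ (k₀ + K)).filter fun k => |X k - round (X k)| < η).card : ℕ) : ℝ) ≤
      (K * d₂ + 3) * (2 * η / d₁ + 1) := by
  set S := (Finset.Ico k₀ (k₀ + K)).filter fun k => |X k - round (X k)| < η with hS
  have hd₂ : 0 ≤ d₂ := le_trans hd₁.le ((hinc 0).trans (hinc2 0))
  rcases Nat.eq_zero_or_pos K with hK | hK
  · have : S = ∅ := by
      rw [hS, hK, add_zero, Finset.Ico_self, Finset.filter_empty]
    rw [this, Finset.card_empty, Nat.cast_zero]
    positivity
  -- growth bounds of the sequence on the window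
  have hmono : ∀ a n, X a ≤ X (a + n) ∧ X (a + n) ≤ X a + n * d₂ := by
    intro a n
    induction n with
    | zero => simp
    | succ n ih =>
      have h1 := hinc (a + n)
      have h2 := hinc2 (a + n)
      rw [show a + (n + 1) = a + n + 1 by omega]
      push_cast
      constructor <;> linarith [ih.1, ih.2, hd₁]
  -- the fibres of `round ∘ X` on `S`
  set f : ℕ → ℤ := fun k => round (X k) with hf
  have hfib : ∀ N ∈ S.image f, (S.filter fun k => f k = N).card ≤ ⌊2 * η / d₁⌋₊ + 1 := by
    intro N _
    refine card_le_of_sub_le fun a ha b hb => ?_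
    rw [Finset.mem_filter] at ha hb
    have ha' := (Finset.mem_filter.mp ha.1).2
    have hb' := (Finset.mem_filter.mp hb.1).2
    rcases le_or_gt a b with hab | hab
    · refine sub_le_of_near hd₁ hinc hab (N := (N : ℝ)) ?_ ?_
      · rw [← ha.2]; exact ha'
      · rw [← hb.2]; exact hb'
    · rw [Nat.sub_eq_zero_of_le hab.le]; exact Nat.zero_le _
  -- the image of `S` lies in an integer interval
  have himg : S.image f ⊆ Finset.Icc ⌊X k₀⌋ ⌈X (k₀ + (K - 1))⌉ := by
    intro N hN
    rw [Finset.mem_image] at hN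
    obtain ⟨k, hk, rfl⟩ := hN
    have hk' := (Finset.mem_Ico.mp (Finset.mem_filter.mp hk).1)
    rw [Finset.mem_Icc]
    have hlo : X k₀ ≤ X k := by
      have := (hmono k₀ (k - k₀)).1; rwa [show k₀ + (k - k₀) = k by omega] at this
    have hhi : X k ≤ X (k₀ + (K - 1)) := by
      have := (hmono k (k₀ + (K - 1) - k)).1
      rwa [show k + (k₀ + (K - 1) - k) = k₀ + (K - 1) by omega] at this
    constructor
    · have h1 : (⌊X k₀⌋ : ℝ) ≤ X k₀ := Int.floor_le _
      have h2 : X k - 1 / 2 < round (X k) := sub_half_lt_round _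
      have : (⌊X k₀⌋ : ℝ) < round (X k) + 1 := by linarith
      exact_mod_cast Int.lt_add_one_iff.mp (by exact_mod_cast this)
    · have h1 : X (k₀ + (K - 1)) ≤ ⌈X (k₀ + (K - 1))⌉ := Int.le_ceil _
      have h2 : (round (X k) : ℝ) ≤ X k + 1 / 2 := round_le_add_half _
      have : (round (X k) : ℝ) < ⌈X (k₀ + (K - 1))⌉ + 1 := by linarith
      exact_mod_cast Int.lt_add_one_iff.mp (by exact_mod_cast this)
  have hcardimg : (((S.image f).card : ℕ) : ℝ) ≤ K * d₂ + 3 := by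
    have h1 : (S.image f).card ≤ (Finset.Icc ⌊X k₀⌋ ⌈X (k₀ + (K - 1))⌉).card := Finset.card_le_card himg
    rw [Int.card_Icc] at h1
    have hspan : (⌈X (k₀ + (K - 1))⌉ : ℝ) + 1 - ⌊X k₀⌋ ≤ K * d₂ + 3 := by
      have h2 := (hmono k₀ (K - 1)).2
      have h3 : (⌈X (k₀ + (K - 1))⌉ : ℝ) < X (k₀ + (K - 1)) + 1 := Int.ceil_lt_add_one _
      have h4 : X k₀ < ⌊X k₀⌋ + 1 := Int.lt_floor_add_one _
      have h5 : ((K - 1 : ℕ) : ℝ) * d₂ ≤ K * d₂ := by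
        refine mul_le_mul_of_nonneg_right ?_ hd₂
        exact_mod_cast Nat.sub_le K 1
      linarith
    have h6 : (((S.image f).card : ℕ) : ℝ) ≤ ((⌈X (k₀ + (K - 1))⌉ + 1 - ⌊X k₀⌋).toNat : ℝ) := by
      exact_mod_cast h1
    refine h6.trans ?_
    rcases le_or_gt 0 (⌈X (k₀ + (K - 1))⌉ + 1 - ⌊X k₀⌋) with hnn | hneg
    · rw [show (((⌈X (k₀ + (K - 1))⌉ + 1 - ⌊X k₀⌋).toNat : ℕ) : ℝ) =
          ((⌈X (k₀ + (K - 1))⌉ + 1 - ⌊X k₀⌋ : ℤ) : ℝ) by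
        rw [← Int.cast_natCast, Int.toNat_of_nonneg hnn]]
      push_cast
      linarith
    · rw [Int.toNat_eq_zero.mpr hneg.le]
      simp only [Nat.cast_zero]
      positivity
  -- assemble with the fibrewise count
  have hcard : S.card = ∑ N ∈ S.image f, (S.filter fun k => f k = N).card :=
    Finset.card_eq_sum_card_image f S
  have hsum : S.card ≤ (S.image f).card * (⌊2 * η / d₁⌋₊ + 1) := by
    rw [hcard]
    calc ∑ N ∈ S.image f, (S.filter fun k => f k = N).card
        ≤ ∑ _N ∈ S.image f, (⌊2 * η / d₁⌋₊ + 1) := Finset.sum_le_sum hfib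
      _ = (S.image f).card * (⌊2 * η / d₁⌋₊ + 1) := by rw [Finset.sum_const, smul_eq_mul]
  have hfl : ((⌊2 * η / d₁⌋₊ : ℕ) : ℝ) ≤ 2 * η / d₁ := Nat.floor_le (by positivity)
  calc ((S.card : ℕ) : ℝ) ≤ (((S.image f).card * (⌊2 * η / d₁⌋₊ + 1) : ℕ) : ℝ) := by exact_mod_cast hsum
    _ = ((S.image f).card : ℝ) * ((⌊2 * η / d₁⌋₊ : ℝ) + 1) := by push_cast; ring
    _ ≤ (K * d₂ + 3) * (2 * η / d₁ + 1) := by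
        refine mul_le_mul hcardimg (by linarith) (by positivity) (by positivity)

/-- **At least `K/2` of `K` consecutive values are at distance `≥ η` from `ℤ`** when
`16ηd₂ ≤ d₁`, `d₂ ≤ 1/8`, `48η ≤ d₁K`, `24 ≤ K`. [cite: AjankiHuveneers2011, Cor. 3.4 (i), (iii); Prop. 5.1 Step 2] -/
theorem card_far_int_ge {X : ℕ → ℝ} {d₁ d₂ η : ℝ} (hd₁ : 0 < d₁) (hη : 0 < η)
    (hinc : ∀ k, d₁ ≤ X (k + 1) - X k) (hinc2 : ∀ k, X (k + 1) - X k ≤ d₂) (k₀ K : ℕ)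
    (h1 : 16 * η * d₂ ≤ d₁) (h2 : d₂ ≤ 1 / 8) (h3 : 48 * η ≤ d₁ * K) (h4 : (24 : ℝ) ≤ K) :
    (K : ℝ) / 2 ≤ (((Finset.Ico k₀ (k₀ + K)).filter fun k => η ≤ |X k - round (X k)|).card : ℕ) := by
  have hbad := card_near_int_le hd₁ hη hinc hinc2 k₀ K
  set S := (Finset.Ico k₀ (k₀ + K)).filter fun k => |X k - round (X k)| < η with hS
  set G := (Finset.Ico k₀ (k₀ + K)).filter fun k => η ≤ |X k - round (X k)| with hG
  have hsplit : G.card + S.card = K := by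
    have h := Finset.card_filter_add_card_filter_not (s := Finset.Ico k₀ (k₀ + K))
      (fun k => η ≤ |X k - round (X k)|)
    have hneg : (Finset.Ico k₀ (k₀ + K)).filter (fun k => ¬ (η ≤ |X k - round (X k)|)) = S := by
      rw [hS]; congr 1; funext k; simp [not_le]
    rw [hneg] at h
    rw [h, Nat.card_Ico]; omega
  have hGr : (G.card : ℝ) = K - S.card := by
    have : ((G.card + S.card : ℕ) : ℝ) = K := by exact_mod_cast hsplit
    push_cast at this; linarith
  rw [hGr]
  -- `S.card ≤ K/2`
  have hd₂ : 0 ≤ d₂ := le_trans hd₁.le ((hinc 0).trans (hinc2 0))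
  have hx : 2 * η / d₁ * d₂ ≤ 1 / 8 := by
    rw [div_mul_eq_mul_div, div_le_iff₀ hd₁]; linarith
  have hy : 3 * (2 * η / d₁) ≤ K / 8 := by
    rw [show 3 * (2 * η / d₁) = 6 * η / d₁ by ring, div_le_iff₀ hd₁]; linarith
  have hK0 : (0 : ℝ) ≤ K := by positivity
  have : (K * d₂ + 3) * (2 * η / d₁ + 1) ≤ K / 2 := by
    have e : (K * d₂ + 3) * (2 * η / d₁ + 1) = K * (2 * η / d₁ * d₂) + K * d₂ + 3 * (2 * η / d₁) + 3 := by
      ring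
    rw [e]
    have t1 : K * (2 * η / d₁ * d₂) ≤ K * (1 / 8) := mul_le_mul_of_nonneg_left hx hK0
    have t2 : (K : ℝ) * d₂ ≤ K * (1 / 8) := mul_le_mul_of_nonneg_left h2 hK0
    linarith
  linarith

/-- **`dist(x, ℤ) ≥ η` forces `sin²(πx) ≥ 4η²`** (`η ≤ 1/2`; Jordan's inequality).
[folklore] -/
theorem sin_sq_ge_of_far_int {x η : ℝ} (hη0 : 0 ≤ η) (hη : η ≤ |x - round x|) :
    4 * η ^ 2 ≤ Real.sin (π * x) ^ 2 := by
  set t := x - round x with ht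
  have ht_half : |t| ≤ 1 / 2 := abs_sub_round x
  have hsin : Real.sin (π * x) ^ 2 = Real.sin (π * t) ^ 2 := by
    have : π * x = π * t + (round x : ℤ) * π := by rw [ht]; ring
    rw [this, Real.sin_add_int_mul_pi, mul_pow, ← sq_abs ((-1 : ℝ) ^ (round x)), abs_neg_one_zpow,
      one_pow, one_mul]
  rw [hsin]
  -- `|sin(π t)| ≥ 2|t| ≥ 2η` for `|t| ≤ 1/2`
  have key : 2 * |t| ≤ |Real.sin (π * t)| := by
    have h0 : 0 ≤ π * |t| := by positivity
    have h1 : π * |t| ≤ π / 2 := by nlinarith [Real.pi_pos]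
    have h2 := Real.mul_le_sin h0 h1
    have h3 : 2 / π * (π * |t|) = 2 * |t| := by field_simp
    rw [h3] at h2
    have h4 : Real.sin (π * |t|) = |Real.sin (π * t)| := by
      rcases le_or_gt 0 t with h | h
      · rw [abs_of_nonneg h, abs_of_nonneg]
        apply Real.sin_nonneg_of_nonneg_of_le_pi (by positivity)
        nlinarith [Real.pi_pos, abs_of_nonneg h]
      · rw [abs_of_neg h, mul_neg, Real.sin_neg, abs_of_nonpos]
        have : Real.sin (π * -t) ≥ 0 := by
          apply Real.sin_nonneg_of_nonneg_of_le_pi (by nlinarith [Real.pi_pos])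
          have := abs_of_neg h
          nlinarith [Real.pi_pos]
        rw [mul_neg, Real.sin_neg] at this
        linarith
    rwa [h4] at h2
  have hη' : η ≤ |t| := hη
  calc 4 * η ^ 2 = (2 * η) ^ 2 := by ring
    _ ≤ (2 * |t|) ^ 2 := pow_le_pow_left₀ (by positivity) (by linarith) 2
    _ ≤ |Real.sin (π * t)| ^ 2 := pow_le_pow_left₀ (by positivity) key 2
    _ = Real.sin (π * t) ^ 2 := sq_abs _

/-! ### The phase chain -/

/-- **Most steps of the phase chain are away from `ℤ`.** For `-1 < b₋ ≤ 0 ≤ b₊` and `κ > 0` there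
are `w₁ > 0` and `η ∈ (0, 1/2]` such that for `0 < w ≤ w₁`, every disorder `B ∈ [b₋, b₊]^ℕ`, every
start `x`, and every window `[k₀, k₀ + K)` with `κ ≤ wK`, at least `K/2` of the indices `k` in the
window satisfy `sin²(πX^x_k) ≥ 4η²`. [cite: AjankiHuveneers2011, Cor. 3.4 (i), (iii); proof of Prop. 5.1, Step 2] -/
theorem ahPhase_far_int_card_ge (bm bp : ℝ) (hbm : -1 < bm) (hbm0 : bm ≤ 0) (hbp : 0 ≤ bp)
    {κ : ℝ} (hκ : 0 < κ) :
    ∃ w₁ : ℝ, 0 < w₁ ∧ ∃ η : ℝ, 0 < η ∧ η ≤ 1 / 2 ∧ ∀ w ∈ Set.Ioc 0 w₁,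
      ∀ (x : ℝ) (B : ℕ → ℝ), (∀ k, B k ∈ Set.Icc bm bp) → ∀ k₀ K : ℕ, κ ≤ w * K →
        (K : ℝ) / 2 ≤ (((Finset.Ico k₀ (k₀ + K)).filter fun k =>
          4 * η ^ 2 ≤ Real.sin (π * ahPhase w x B k) ^ 2).card : ℕ) := by
  obtain ⟨w₀, hw₀, C, hC⟩ := ahStep_increment_bounds bm bp hbm hbm0 hbp
  have h1bm : 0 < 1 + bm := by linarith
  set η : ℝ := min ((1 + bm) / (32 * (2 + bp))) ((1 + bm) * κ / 96) with hη
  have hη0 : 0 < η := by rw [hη]; exact lt_min (by positivity) (by positivity)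
  have hη1 : η ≤ (1 + bm) / (32 * (2 + bp)) := min_le_left _ _
  have hη2 : η ≤ (1 + bm) * κ / 96 := min_le_right _ _
  have hηhalf : η ≤ 1 / 2 := by
    refine hη1.trans ?_
    rw [div_le_iff₀ (by positivity)]; nlinarith
  set w₁ : ℝ := min w₀ (min ((1 + bm) / (2 * (|C| + 1))) (min (1 / (8 * (2 + bp))) (κ / 24))) with hw₁
  have hw₁0 : 0 < w₁ := by
    rw [hw₁]
    refine lt_min hw₀ (lt_min (by positivity) (lt_min (by positivity) (by positivity)))
  refine ⟨w₁, hw₁0, η, hη0, hηhalf, ?_⟩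
  intro w hw x B hB k₀ K hK
  obtain ⟨hw0, hwle⟩ := hw
  have hwa : w ≤ w₀ := hwle.trans (min_le_left _ _)
  have hwb : w ≤ (1 + bm) / (2 * (|C| + 1)) := hwle.trans ((min_le_right _ _).trans (min_le_left _ _))
  have hwc : w ≤ 1 / (8 * (2 + bp)) :=
    hwle.trans ((min_le_right _ _).trans ((min_le_right _ _).trans (min_le_left _ _)))
  have hwd : w ≤ κ / 24 :=
    hwle.trans ((min_le_right _ _).trans ((min_le_right _ _).trans (min_le_right _ _)))
  -- increments
  set d₁ : ℝ := (1 + bm) * w - C * w ^ 2 with hd₁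
  set d₂ : ℝ := (1 + bp) * w + C * w ^ 2 with hd₂
  have hCw : |C| * w ≤ (1 + bm) / 2 := by
    have : w * (|C| + 1) ≤ (1 + bm) / 2 := by
      rw [le_div_iff₀ (by positivity)] at hwb; linarith
    nlinarith [abs_nonneg C]
  have hCw2 : |C * w ^ 2| ≤ (1 + bm) / 2 * w := by
    rw [abs_mul, abs_of_nonneg (sq_nonneg w), sq, ← mul_assoc]
    exact mul_le_mul_of_nonneg_right hCw hw0.le
  have hd₁lo : (1 + bm) * w / 2 ≤ d₁ := by
    rw [hd₁]; have := (abs_le.mp hCw2).2; linarith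
  have hd₁pos : 0 < d₁ := lt_of_lt_of_le (by positivity) hd₁lo
  have hd₂hi : d₂ ≤ (2 + bp) * w := by
    rw [hd₂]; have := (abs_le.mp hCw2).2; nlinarith
  have hinc : ∀ k, d₁ ≤ ahPhase w x B (k + 1) - ahPhase w x B k := fun k => by
    rw [ahPhase_succ]; exact (hC w ⟨hw0, hwa⟩ _ _ (hB k)).2.1
  have hinc2 : ∀ k, ahPhase w x B (k + 1) - ahPhase w x B k ≤ d₂ := fun k => by
    rw [ahPhase_succ]; exact (hC w ⟨hw0, hwa⟩ _ _ (hB k)).2.2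
  -- the four smallness conditions
  have hc1 : 16 * η * d₂ ≤ d₁ := by
    have : 16 * η * ((2 + bp) * w) ≤ (1 + bm) * w / 2 := by
      have h := mul_le_mul_of_nonneg_right hη1 (by positivity : (0 : ℝ) ≤ 16 * (2 + bp) * w)
      have e : (1 + bm) / (32 * (2 + bp)) * (16 * (2 + bp) * w) = (1 + bm) * w / 2 := by
        field_simp; ring
      rw [e] at h; nlinarith
    nlinarith [mul_le_mul_of_nonneg_left hd₂hi (by positivity : (0 : ℝ) ≤ 16 * η)]
  have hc2 : d₂ ≤ 1 / 8 := by
    refine hd₂hi.trans ?_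
    rw [le_div_iff₀ (by positivity)] at hwc; nlinarith
  have hc3 : 48 * η ≤ d₁ * K := by
    have : 48 * η ≤ (1 + bm) * κ / 2 := by nlinarith
    have h2 : (1 + bm) * κ / 2 ≤ (1 + bm) * w / 2 * K := by
      have := mul_le_mul_of_nonneg_left hK (by positivity : (0 : ℝ) ≤ (1 + bm) / 2)
      nlinarith
    have hK0 : (0 : ℝ) ≤ K := Nat.cast_nonneg K
    nlinarith [mul_le_mul_of_nonneg_right hd₁lo hK0]
  have hc4 : (24 : ℝ) ≤ K := by
    have : κ ≤ w * K := hK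
    have h24 : 24 * w ≤ κ := by rw [le_div_iff₀ (by norm_num : (0:ℝ) < 24)] at hwd; linarith
    nlinarith
  have hmain := card_far_int_ge hd₁pos hη0 hinc hinc2 k₀ K hc1 hc2 hc3 hc4
  refine hmain.trans ?_
  have hsub : ((Finset.Ico k₀ (k₀ + K)).filter fun k => η ≤ |ahPhase w x B k - round (ahPhase w x B k)|) ⊆
      ((Finset.Ico k₀ (k₀ + K)).filter fun k => 4 * η ^ 2 ≤ Real.sin (π * ahPhase w x B k) ^ 2) := by
    intro k hk
    rw [Finset.mem_filter] at hk ⊢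
    exact ⟨hk.1, sin_sq_ge_of_far_int hη0.le hk.2⟩
  exact_mod_cast Finset.card_le_card hsub

end Literature.Barriers.AtomisticToContinuum.HeatConduction

end
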